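import Literature.AlgebraicGeometry.Resolution.RegularCentreBlowupSeqExtensionIso
import Literature.AlgebraicGeometry.Resolution.BlowupStalkCharts
import Literature.AlgebraicGeometry.Resolution.GenericPointStalkData
import Literature.AlgebraicGeometry.Resolution.NonPrincipalLocus
import Literature.AlgebraicGeometry.Resolution.BlowupsProperProofs
import Literature.AlgebraicGeometry.Resolution.QuadraticTransformsKeyLemma
import HarnessLib

/-!
# A Cossart–Piltant sequence over the generic point of a curve is one blowing up of a point

Topic: `Literature/AlgebraicGeometry/Resolution`. Let `U` be an integral locally Noetherian scheme,
`x ∈ U` a point whose local ring is regular of dimension two (the generic point of a "curve" in a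
regular threefold), `C = cl{x}` and `𝓘 = 𝓘_C` its ideal sheaf. Along a finite sequence
`σ : S' → U` of blowing ups with regular integral centres contained in the non-locally-principal
loci of the transforms of `𝓘` (`IsRegularCentreBlowupSeq σ 𝓘`, the shape of Cossart–Piltant's
principalization, `Principalization.lean`) the following alternative holds
(`IsRegularCentreBlowupSeq.tower_alternative`): EITHER `σ` is still an isomorphism over a
neighbourhood of `x` and `𝓘𝒪` is not locally principal at the point over `x`, OR every point `s'`
of `S'` over `x` has `𝓘𝒪_{S',s'}` locally principal and its local ring presented as a localization
of a chart of the blowing up of the CLOSED POINT of `Spec 𝒪_{U,x}` (`ChartPresentation`, the shape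
of `IsBlowup.exists_reesChart_stalk`). The point is that the first centre meeting the fibre over
`x` is, near that fibre, the curve itself, whose ideal at `x` is the maximal ideal
(`stalkIdeal_vanishingIdeal_eq_maximalIdeal_of_closure_eq`), and that afterwards `𝓘𝒪` is
principal over `x` so that no later centre meets the fibre. Consequently, once `𝓘𝒪_{S'}` is locally
principal (the output of `CossartPiltant2019Principalization`), the local rings of `S'` at the points
over `x` are the local rings of the blowing up of `Spec 𝒪_{U,x}` at its closed point
(`IsRegularCentreBlowupSeq.chartPresentation_of_isLocallyPrincipal`) — Zariski's dictionary
"blowing up the curve `C` = blowing up the point `x` of the surface `Spec 𝒪_{U,x}` transversal to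
it" (Piltant 2013, proof of Lemma 5.6: "`X'₂,x' = X'₂ ×_{X₁} Spec 𝒪_{X₁,x}`"). All PROVED.

## References

* O. Piltant, RACSAM 107 (2013), proof of Prop. 5.1, Lemmas 5.3 and 5.6. [Piltant2013]
* V. Cossart, O. Piltant, J. Algebra 529 (2019), Prop. 4.4 (arXiv v1: Prop. 4.3). [CossartPiltant2019]
* The Stacks Project, Tag 0804 (charts of a blowing up). [StacksProject]
-/

noncomputable section

open CategoryTheory CategoryTheory.Limits AlgebraicGeometry TopologicalSpace IsLocalRing
open Scheme.IdealSheafData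

namespace Literature.AlgebraicGeometry.Resolution

universe u

variable {U : Scheme.{u}}

/-! ## Chart presentations of a local ring over `𝒪_{U,σ s'}` -/

/-- **Chart presentation** of the local ring of `S'` at `s'` over `𝒪_{U,σ s'}` along `σ : S' → U`:
up to an isomorphism `e : 𝒪_{U,σ s'} ≅ B`, there are generators `c₀, c₁` of `𝔪_B`, a chart ring
`B_j = B[c/c_j]` of the blowing up of the closed point of `Spec B`, a prime `𝔴` of `B_j` over
`𝔪_B` and a ring homomorphism `χ : B_j → 𝒪_{S',s'}` compatible with `σ^♯_{s'}` presenting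
`𝒪_{S',s'}` as `(B_j)_𝔴` (the conclusion shape of `IsBlowup.exists_reesChart_stalk`).
[cite: StacksProject, Tag 0804] -/
def ChartPresentation {S' : Scheme.{u}} (σ : S' ⟶ U) (s' : S') : Prop :=
  ∃ (B : CommRingCat.{u}) (_ : IsLocalRing B) (e : U.presheaf.stalk (σ s') ≅ B)
    (c : Fin 2 → B) (_ : Ideal.span (Set.range c) = maximalIdeal B) (j : Fin 2)
    (𝔴 : PrimeSpectrum (chartRing c j)) (χ : chartRing c j →+* S'.presheaf.stalk s'),
    (∀ b, χ (chartBase c j b) = (σ.stalkMap s').hom (e.inv b)) ∧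
    @IsLocalization.AtPrime _ _ (S'.presheaf.stalk s') _ χ.toAlgebra 𝔴.asIdeal _ ∧
    𝔴.asIdeal.comap (chartBase c j) = maximalIdeal B

/-- **Chart presentations pass along local isomorphisms**: if `τ : S'' → S'` induces an
isomorphism of local rings at `s''`, a chart presentation of `𝒪_{S',τ s''}` along `σ` gives one of
`𝒪_{S'',s''}` along `τ ≫ σ`. [folklore] -/
theorem ChartPresentation.comp_of_isIso_stalkMap {S' S'' : Scheme.{u}} {σ : S' ⟶ U} {τ : S'' ⟶ S'}
    {s'' : S''} (h : ChartPresentation σ (τ s'')) [IsIso (τ.stalkMap s'')] :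
    ChartPresentation (τ ≫ σ) s'' := by
  obtain ⟨B, hB, e, c, hc, j, 𝔴, χ, hχ, hloc, hcomap⟩ := h
  let t : S'.presheaf.stalk (τ s'') ≃+* S''.presheaf.stalk s'' :=
    (asIso (τ.stalkMap s'')).commRingCatIsoToRingEquiv
  let χ' : chartRing c j →+* S''.presheaf.stalk s'' := t.toRingHom.comp χ
  refine ⟨B, hB, e, c, hc, j, 𝔴, χ', fun b => ?_, ?_, hcomap⟩
  · change t (χ (chartBase c j b)) = ((τ ≫ σ).stalkMap s'').hom (e.inv b)
    rw [hχ, Scheme.Hom.stalkMap_comp]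
    rfl
  · letI : Algebra (chartRing c j) (S'.presheaf.stalk (τ s'')) := χ.toAlgebra
    letI : Algebra (chartRing c j) (S''.presheaf.stalk s'') := χ'.toAlgebra
    haveI := hloc
    let ta : S'.presheaf.stalk (τ s'') ≃ₐ[chartRing c j] S''.presheaf.stalk s'' :=
      { t with commutes' := fun _ => rfl }
    exact IsLocalization.isLocalization_of_algEquiv 𝔴.asIdeal.primeCompl ta

/-! ## Local principality along local isomorphisms -/

/-- Local principality pulls back along any morphism. [folklore] -/
theorem IsLocallyPrincipalAt.comap' {S' S'' : Scheme.{u}} [IsLocallyNoetherian S']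
    [IsLocallyNoetherian S''] {K : S'.IdealSheafData} (τ : S'' ⟶ S') {s'' : S''}
    (h : IsLocallyPrincipalAt K (τ s'')) : IsLocallyPrincipalAt (K.comap τ) s'' := by
  rw [isLocallyPrincipalAt_iff_isPrincipal_stalkIdeal] at h ⊢
  rw [stalkIdeal_comap_eq_map_stalkMap]
  obtain ⟨g, hg⟩ := h
  exact ⟨⟨(τ.stalkMap s'').hom g, by rw [hg, Ideal.submodule_span_eq, Ideal.map_span,
    Set.image_singleton, Ideal.submodule_span_eq]⟩⟩

/-- Local principality descends along a local isomorphism. [folklore] -/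
theorem isLocallyPrincipalAt_of_comap_of_isIso_stalkMap {S' S'' : Scheme.{u}} [IsLocallyNoetherian S']
    [IsLocallyNoetherian S''] {K : S'.IdealSheafData} (τ : S'' ⟶ S') {s'' : S''}
    [IsIso (τ.stalkMap s'')] (h : IsLocallyPrincipalAt (K.comap τ) s'') :
    IsLocallyPrincipalAt K (τ s'') := by
  rw [isLocallyPrincipalAt_iff_isPrincipal_stalkIdeal] at h ⊢
  rw [stalkIdeal_comap_eq_map_stalkMap] at h
  obtain ⟨g, hg⟩ := h
  let t : S'.presheaf.stalk (τ s'') ≃+* S''.presheaf.stalk s'' :=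
    (asIso (τ.stalkMap s'')).commRingCatIsoToRingEquiv
  have hcomp : t.symm.toRingHom.comp (τ.stalkMap s'').hom = RingHom.id _ :=
    RingHom.ext fun a => t.symm_apply_apply a
  have : stalkIdeal K (τ s'') =
      ((stalkIdeal K (τ s'')).map (τ.stalkMap s'').hom).map t.symm.toRingHom := by
    rw [Ideal.map_map, hcomp, Ideal.map_id]
  refine ⟨⟨t.symm g, ?_⟩⟩
  rw [this, hg, Ideal.submodule_span_eq, Ideal.map_span, Set.image_singleton, Ideal.submodule_span_eq]
  rfl

/-! ## A blowing up is a local isomorphism off its centre -/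

/-- Off the centre of a blowing up the stalk map is an isomorphism. [cite: GortzWedhorn2020, Prop. 13.91 (3)] -/
theorem IsBlowup.isIso_stalkMap_of_not_mem_support' {S' S'' : Scheme.{u}} {τ : S'' ⟶ S'}
    {C : S'.IdealSheafData} (hτ : IsBlowup τ C) {s'' : S''} (h : τ s'' ∉ C.support) :
    IsIso (τ.stalkMap s'') := by
  set W₀ : S'.Opens := ⟨(C.support : Set S')ᶜ, C.support.isClosed.isOpen_compl⟩
  haveI : IsIso (τ ∣_ W₀) := hτ.isIso_compl
  exact isIso_stalkMap_of_isIso_morphismRestrict τ W₀ s'' h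

/-! ## The alternative along a Cossart–Piltant sequence -/

section Tower

variable [IsIntegral U] [IsLocallyNoetherian U] (x : U)

/-- The ideal sheaf of the curve `C = cl{x}`. [folklore] -/
abbrev curveIdeal : U.IdealSheafData :=
  vanishingIdeal ⟨closure ({x} : Set U), isClosed_closure⟩

omit [IsIntegral U] [IsLocallyNoetherian U] in
/-- The support of `𝓘_C` is `C = cl{x}`. [folklore] -/
theorem support_curveIdeal : ((curveIdeal x).support : Set U) = closure {x} :=
  Scheme.IdealSheafData.coe_support_vanishingIdeal _

omit [IsIntegral U] in
/-- **`𝓘_C` is not locally principal at `x`** when `𝒪_{U,x}` is regular of dimension two (its stalk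
is the maximal ideal, which needs two generators). [folklore] -/
theorem not_isLocallyPrincipalAt_curveIdeal [IsRegularLocalRing (U.presheaf.stalk x)]
    (hx2 : ringKrullDim (U.presheaf.stalk x) = 2) : ¬ IsLocallyPrincipalAt (curveIdeal x) x := by
  rw [isLocallyPrincipalAt_iff_isPrincipal_stalkIdeal, curveIdeal,
    stalkIdeal_vanishingIdeal_closure_self]
  rintro ⟨g, hg⟩
  exact maximalIdeal_ne_span_singleton hx2 g (by rw [hg, Ideal.submodule_span_eq])

/-- **Not yet**: `σ` is an isomorphism over a neighbourhood of `x`, and `𝓘𝒪` is not locally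
principal at the points over `x`. [folklore] -/
def TowerNotYet {S' : Scheme.{u}} (σ : S' ⟶ U) : Prop :=
  ∃ W : U.Opens, x ∈ W ∧ IsIso (σ ∣_ W) ∧
    ∀ s' : S', σ s' = x → ¬ IsLocallyPrincipalAt ((curveIdeal x).comap σ) s'

/-- **Done**: every point over `x` has a chart presentation and `𝓘𝒪` is locally principal there.
[folklore] -/
def TowerDone {S' : Scheme.{u}} (σ : S' ⟶ U) : Prop :=
  ∀ s' : S', σ s' = x → ChartPresentation σ s' ∧ IsLocallyPrincipalAt ((curveIdeal x).comap σ) s'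

variable {x}

omit [IsIntegral U] [IsLocallyNoetherian U] in
/-- In the "not yet" state there is exactly one point over `x`. [folklore] -/
theorem TowerNotYet.existsUnique {S' : Scheme.{u}} {σ : S' ⟶ U} (h : TowerNotYet x σ) :
    ∃! s₀ : S', σ s₀ = x := by
  obtain ⟨W, hxW, hiso, -⟩ := h
  haveI := hiso
  obtain ⟨y, hy⟩ := (σ ∣_ W).surjective ⟨x, hxW⟩
  have hval : ∀ s : (σ ⁻¹ᵁ W : S'.Opens), ((σ ∣_ W) s).1 = σ s.1 := fun s =>
    morphismRestrict_base_coe σ W s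
  have hy1 : σ y.1 = x := by
    have := hval y
    rw [hy] at this
    exact this.symm
  refine ⟨y.1, hy1, fun s hs => ?_⟩
  have hsW : s ∈ σ ⁻¹ᵁ W := show σ s ∈ W by rw [hs]; exact hxW
  have hinj := (ConcreteCategory.bijective_of_isIso (σ ∣_ W).base).1
  have h1 : (σ ∣_ W) ⟨s, hsW⟩ = (σ ∣_ W) y := by
    rw [hy]; apply Subtype.ext; rw [hval]; exact hs
  exact congrArg Subtype.val (hinj h1)

omit [IsIntegral U] in
/-- The initial stage is "not yet". [folklore] -/
theorem towerNotYet_id (x : U) [IsRegularLocalRing (U.presheaf.stalk x)]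
    (hx2 : ringKrullDim (U.presheaf.stalk x) = 2) : TowerNotYet x (𝟙 U) := by
  refine ⟨⊤, trivial, inferInstance, fun s' hs' => ?_⟩
  rw [Scheme.IdealSheafData.comap_id]
  change s' = x at hs'
  subst hs'
  exact not_isLocallyPrincipalAt_curveIdeal s' hx2

/-! ### The key step: blowing up the curve through the point over `x` -/

omit [IsIntegral U] [IsLocallyNoetherian U] in
/-- A bijective local homomorphism of local rings maps the maximal ideal onto the maximal ideal.
[folklore] -/
theorem map_maximalIdeal_of_bijective {A B : Type*} [CommRing A] [CommRing B] [IsLocalRing A]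
    [IsLocalRing B] (f : A →+* B) [IsLocalHom f] (hf : Function.Surjective f) :
    (maximalIdeal A).map f = maximalIdeal B := by
  refine le_antisymm ?_ fun b hb => ?_
  · exact (Ideal.map_le_iff_le_comap).mpr (by
      intro a ha
      rw [Ideal.mem_comap, mem_maximalIdeal, mem_nonunits_iff]
      exact fun hu => ha (isUnit_of_map_unit f a hu))
  · obtain ⟨a, rfl⟩ := hf b
    exact Ideal.mem_map_of_mem _ (by
      rw [mem_maximalIdeal, mem_nonunits_iff] at hb ⊢
      exact fun hu => hb (hu.map f))

omit [IsIntegral U] [IsLocallyNoetherian U] in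
/-- **Blowing up the curve through a point `p` with regular two-dimensional local ring, at which
it is generic** (`Y = cl{p}`): every point `s''` over `p` gets a chart presentation along `τ ≫ σ`
(when `σ` is a local isomorphism at `p`), and any ideal sheaf whose stalk at `p` is `𝔪_p`
becomes principal at `s''` (`𝔪_p 𝒪_{s''} = c_j 𝒪_{s''}`).
[cite: StacksProject, Tag 0804] -/
theorem chartPresentation_of_blowup_generic {S' S'' : Scheme.{u}} [IsLocallyNoetherian S']
    [IsLocallyNoetherian S''] (σ : S' ⟶ U) {τ : S'' ⟶ S'} {Y : Closeds S'}
    (hτ : IsBlowup τ (vanishingIdeal Y)) (p : S') [IsIso (σ.stalkMap p)]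
    [IsRegularLocalRing (S'.presheaf.stalk p)] (hp2 : ringKrullDim (S'.presheaf.stalk p) = 2)
    (hY : (Y : Set S') = closure {p}) (s'' : S'') (hs : τ s'' = p) :
    ChartPresentation (τ ≫ σ) s'' ∧
      ∀ K : S'.IdealSheafData, stalkIdeal K p = maximalIdeal _ → IsLocallyPrincipalAt (K.comap τ) s'' := by
  subst hs
  -- generators of `𝔪_p = 𝓘_{Y,p}`
  obtain ⟨x₀, y₀, hm, -, -, -, -⟩ := exists_maximalIdeal_eq_span_pair (R := S'.presheaf.stalk (τ s'')) hp2
  let c : Fin 2 → S'.presheaf.stalk (τ s'') := ![x₀, y₀]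
  have hrange : Set.range c = {x₀, y₀} := by
    ext z
    simp only [Set.mem_range, Set.mem_insert_iff, Set.mem_singleton_iff]
    constructor
    · rintro ⟨i, rfl⟩
      fin_cases i
      · exact Or.inl rfl
      · exact Or.inr rfl
    · rintro (rfl | rfl)
      exacts [⟨0, rfl⟩, ⟨1, rfl⟩]
  have hcm : Ideal.span (Set.range c) = maximalIdeal _ := by rw [hrange, ← hm]
  have hc : Ideal.span (Set.range c) = stalkIdeal (vanishingIdeal Y) (τ s'') := by
    rw [hcm, stalkIdeal_vanishingIdeal_eq_maximalIdeal_of_closure_eq hY]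
  obtain ⟨j, 𝔴, χ, hχ, hloc, hcomap⟩ := hτ.exists_reesChart_stalk s'' c hc
  let e : U.presheaf.stalk (σ (τ s'')) ≅ S'.presheaf.stalk (τ s'') := asIso (σ.stalkMap (τ s''))
  have he : ∀ b, (σ.stalkMap (τ s'')).hom (e.inv b) = b := fun b => by
    rw [← CommRingCat.comp_apply, show e.inv ≫ σ.stalkMap (τ s'') = 𝟙 _ from e.inv_hom_id,
      CommRingCat.id_apply]
  refine ⟨⟨S'.presheaf.stalk (τ s''), inferInstance, e, c, hcm, j, 𝔴, χ,
    fun b => ?_, hloc, hcomap⟩, fun K hK => ?_⟩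
  · rw [hχ b, Scheme.Hom.stalkMap_comp]
    change _ = (τ.stalkMap s'').hom ((σ.stalkMap (τ s'')).hom (e.inv b))
    rw [he]
  · -- `K_p 𝒪_{s''} = 𝔪_p 𝒪_{s''} = (χ φ c_j)`
    rw [isLocallyPrincipalAt_iff_isPrincipal_stalkIdeal, stalkIdeal_comap_eq_map_stalkMap, hK, ← hcm,
      Ideal.map_span]
    refine ⟨⟨χ (chartBase c j (c j)), ?_⟩⟩
    rw [Ideal.submodule_span_eq]
    apply le_antisymm
    · rw [Ideal.span_le]
      rintro _ ⟨_, ⟨i, rfl⟩, rfl⟩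
      rw [SetLike.mem_coe, Ideal.mem_span_singleton']
      refine ⟨χ (chartGen c j i), ?_⟩
      rw [← hχ, reesChartBase_apply_eq_mul_chartGen c j i, map_mul]
      exact mul_comm _ _
    · rw [Ideal.span_singleton_le_iff_mem, hχ]
      exact Ideal.subset_span ⟨c j, ⟨j, rfl⟩, rfl⟩

/-! ### The induction -/

omit [IsIntegral U] [IsLocallyNoetherian U] in
/-- **The alternative along a Cossart–Piltant sequence for the curve `cl{x}`**: for `x` with
regular two-dimensional local ring and `σ : S' → U` a sequence of blowing ups along regular integral
centres in the non-locally-principal loci of the transforms of `𝓘_{cl{x}}`, either `σ` is an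
isomorphism near `x` with `𝓘𝒪` non-principal at the point over `x`, or every point over `x` has a
chart presentation (its local ring is a local ring of the blowing up of the closed point of
`Spec 𝒪_{U,x}`) and `𝓘𝒪` locally principal there. [cite: Piltant2013, Lemma 5.6 (proof)] -/
theorem IsRegularCentreBlowupSeq.tower_alternative {S' : Scheme.{u}} {σ : S' ⟶ U}
    {J : U.IdealSheafData} (hσ : IsRegularCentreBlowupSeq σ J) [hUn : IsLocallyNoetherian U]
    [hS'n : IsLocallyNoetherian S'] (x : U) [hxr : IsRegularLocalRing (U.presheaf.stalk x)]
    (hx2 : ringKrullDim (U.presheaf.stalk x) = 2) (hJ : J = curveIdeal x) :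
    TowerNotYet x σ ∨ TowerDone x σ := by
  induction hσ generalizing hUn hS'n with
  | nil J =>
    subst hJ
    exact Or.inl (towerNotYet_id x hx2)
  | @cons S'' S' S₀ τ σ J Y hσ hint hreg hY hτ ih =>
    subst hJ
    haveI hS'noeth : IsLocallyNoetherian S' :=
      haveI := hσ.isProper stacks02NS_holds inferInstance
      LocallyOfFiniteType.isLocallyNoetherian σ
    have hYsupp : ∀ y ∈ (Y : Set S'), y ∈ ((curveIdeal x).comap σ).support := fun y hy => by
      by_contra h; exact hY y hy (isLocallyPrincipalAt_of_not_mem_support h)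
    rcases ih x hx2 rfl with hnot | hdone
    · -- "not yet": the unique point `s₀` over `x`
      obtain ⟨s₀, hs₀, huniq⟩ := hnot.existsUnique
      obtain ⟨W, hxW, hiso, hnp⟩ := hnot
      haveI := hiso
      by_cases hs₀Y : s₀ ∈ (Y : Set S')
      · -- the centre goes through `s₀`: this stage blows up the curve at `s₀`; "done" afterwards
        right
        haveI hisoσ : IsIso (σ.stalkMap s₀) :=
          isIso_stalkMap_of_isIso_morphismRestrict σ W s₀ (by rw [hs₀]; exact hxW)
        let eσ : S₀.presheaf.stalk (σ s₀) ≃+* S'.presheaf.stalk s₀ :=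
          (asIso (σ.stalkMap s₀)).commRingCatIsoToRingEquiv
        have hregx : ∀ y, y = x → IsRegularLocalRing (S₀.presheaf.stalk y) ∧
            ringKrullDim (S₀.presheaf.stalk y) = 2 ∧
            stalkIdeal (curveIdeal x) y = maximalIdeal _ := by
          rintro y rfl
          exact ⟨inferInstance, hx2, stalkIdeal_vanishingIdeal_closure_self _⟩
        obtain ⟨hreg₀, hdim₀, hstalk₀⟩ := hregx (σ s₀) hs₀
        haveI := hreg₀
        haveI : IsRegularLocalRing (S'.presheaf.stalk s₀) := IsRegularLocalRing.of_ringEquiv eσ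
        have hdims₀ : ringKrullDim (S'.presheaf.stalk s₀) = 2 := by
          rw [← hdim₀]; exact (ringKrullDim_eq_of_ringEquiv eσ).symm
        -- `Y = cl{s₀}`
        have hYeq : (Y : Set S') = closure {s₀} := by
          haveI : IrreducibleSpace (vanishingIdeal Y).subscheme := inferInstance
          have hirr : IsIrreducible (Y : Set S') := by
            have h := (IrreducibleSpace.isIrreducible_univ (X := (vanishingIdeal Y).subscheme)).image
              (vanishingIdeal Y).subschemeι (vanishingIdeal Y).subschemeι.continuous.continuousOn
            rwa [Set.image_univ, range_subschemeι, Scheme.IdealSheafData.coe_support_vanishingIdeal] at h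
          set ζ := hirr.genericPoint with hζdef
          have hζ : IsGenericPoint ζ (Y : Set S') := by
            have := hirr.isGenericPoint_genericPoint_closure
            rwa [Y.isClosed.closure_eq] at this
          have hζY : ζ ∈ (Y : Set S') := hζ.mem
          -- `σ ζ = x`, hence `ζ = s₀`
          have hσζ : σ ζ = x := by
            have h1 : σ ζ ∈ closure ({x} : Set S₀) := by
              have := hYsupp ζ hζY
              rw [Scheme.IdealSheafData.support_comap] at this
              change σ ζ ∈ ((curveIdeal x).support : Set S₀) at this
              rwa [support_curveIdeal] at this
            have h2 : x ⤳ σ ζ := specializes_iff_mem_closure.mpr h1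
            have h3 : ζ ⤳ s₀ := hζ.specializes hs₀Y
            have h4 : σ ζ ⤳ x := by rw [← hs₀]; exact h3.map σ.continuous
            exact (h4.antisymm h2).eq
          have hζs₀ : ζ = s₀ := huniq ζ hσζ
          rw [← hζs₀]
          exact hζ.symm ▸ (hζ : closure {ζ} = _).symm
        refine fun s'' hs'' => ?_
        have hτs'' : τ s'' = s₀ := huniq (τ s'') hs''
        obtain ⟨hcp, hprinc⟩ := chartPresentation_of_blowup_generic σ hτ s₀ hdims₀ hYeq s'' hτs''
        refine ⟨hcp, ?_⟩
        rw [Scheme.IdealSheafData.comap_comp]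
        apply hprinc
        rw [stalkIdeal_comap_eq_map_stalkMap, hstalk₀]
        exact map_maximalIdeal_of_bijective _ eσ.surjective
      · -- the centre misses `s₀`: still "not yet", over a smaller neighbourhood of `x`
        left
        haveI : IsProper σ := hσ.isProper stacks02NS_holds inferInstance
        have hclosed : IsClosed (σ '' (Y : Set S')) := σ.isClosedMap _ Y.isClosed
        have hxnot : x ∉ σ '' (Y : Set S') := by
          rintro ⟨y, hy, hyx⟩
          exact hs₀Y (huniq y hyx ▸ hy)
        let W' : S₀.Opens := W ⊓ ⟨(σ '' (Y : Set S'))ᶜ, hclosed.isOpen_compl⟩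
        have hxW' : x ∈ W' := ⟨hxW, hxnot⟩
        haveI hσW' : IsIso (σ ∣_ W') := isIso_morphismRestrict_of_le σ hiso inf_le_left
        haveI hτW' : IsIso (τ ∣_ σ ⁻¹ᵁ W') := by
          refine hτ.isIso_morphismRestrict (Set.disjoint_left.mpr ?_)
          intro s hs hsY
          rw [Scheme.IdealSheafData.coe_support_vanishingIdeal] at hsY
          exact hs.2 ⟨s, hsY, rfl⟩
        refine ⟨W', hxW', isIso_morphismRestrict_comp τ σ W', fun s'' hs'' hlp => ?_⟩
        have hτs'' : τ s'' = s₀ := huniq (τ s'') hs''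
        have hτs''Y : τ s'' ∉ (vanishingIdeal Y).support := fun h => by
          have h' : τ s'' ∈ (Y : Set S') := by
            rw [← Scheme.IdealSheafData.coe_support_vanishingIdeal Y]; exact h
          exact hs₀Y (hτs'' ▸ h')
        haveI := hτ.isIso_stalkMap_of_not_mem_support' hτs''Y
        apply hnp (τ s'') hs''
        rw [Scheme.IdealSheafData.comap_comp] at hlp
        exact isLocallyPrincipalAt_of_comap_of_isIso_stalkMap τ hlp
    · -- "done" persists: the centre misses the fibre over `x`
      right
      intro s'' hs''
      obtain ⟨hcp, hlp⟩ := hdone (τ s'') hs''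
      have hτs''Y : τ s'' ∉ (vanishingIdeal Y).support := fun h => by
        have h' : τ s'' ∈ (Y : Set S') := by
          rw [← Scheme.IdealSheafData.coe_support_vanishingIdeal Y]; exact h
        exact hY _ h' hlp
      haveI := hτ.isIso_stalkMap_of_not_mem_support' hτs''Y
      refine ⟨hcp.comp_of_isIso_stalkMap, ?_⟩
      rw [Scheme.IdealSheafData.comap_comp]
      exact hlp.comap' τ

omit [IsIntegral U] [IsLocallyNoetherian U] in
/-- **Zariski's dictionary** ("blowing up the curve `C` through `x` = blowing up the closed point
of `Spec 𝒪_{U,x}`"): once `𝓘_C 𝒪_{S'}` is locally principal over `x` along a Cossart–Piltant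
sequence for `𝓘_C`, every local ring of `S'` at a point over `x` is a local ring of the blowing
up of the closed point of `Spec 𝒪_{U,x}` (a chart presentation).
[cite: Piltant2013, Lemma 5.6 (proof: `X'₂ ×_{X₁} Spec 𝒪_{X₁,x₁}` is the blowing up along `x₁`)] -/
theorem IsRegularCentreBlowupSeq.chartPresentation_of_isLocallyPrincipalAt {S' : Scheme.{u}}
    {σ : S' ⟶ U} (hσ : IsRegularCentreBlowupSeq σ (curveIdeal x)) [IsLocallyNoetherian U]
    [IsLocallyNoetherian S'] [IsRegularLocalRing (U.presheaf.stalk x)]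
    (hx2 : ringKrullDim (U.presheaf.stalk x) = 2)
    (hprinc : ∀ s' : S', σ s' = x → IsLocallyPrincipalAt ((curveIdeal x).comap σ) s')
    (s' : S') (hs' : σ s' = x) : ChartPresentation σ s' := by
  rcases hσ.tower_alternative x hx2 rfl with h | h
  · obtain ⟨-, -, -, hnp⟩ := h
    exact absurd (hprinc s' hs') (hnp s' hs')
  · exact (h s' hs').1

omit [IsIntegral U] [IsLocallyNoetherian U] in
/-- Along a Cossart–Piltant sequence for `𝓘_C` that is "not yet" finished over `x` there is a
neighbourhood of `x` over which it is an isomorphism; otherwise every point over `x` has a chart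
presentation: the dichotomy of `tower_alternative` in the form used by the bad-curve induction.
[cite: Piltant2013, Lemma 5.6 (proof)] -/
theorem IsRegularCentreBlowupSeq.exists_isIso_or_chartPresentation {S' : Scheme.{u}}
    {σ : S' ⟶ U} (hσ : IsRegularCentreBlowupSeq σ (curveIdeal x)) [IsLocallyNoetherian U]
    [IsLocallyNoetherian S'] [IsRegularLocalRing (U.presheaf.stalk x)]
    (hx2 : ringKrullDim (U.presheaf.stalk x) = 2) :
    (∃ W : U.Opens, x ∈ W ∧ IsIso (σ ∣_ W)) ∨
      ∀ s' : S', σ s' = x →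
        ChartPresentation σ s' ∧ IsLocallyPrincipalAt ((curveIdeal x).comap σ) s' := by
  rcases hσ.tower_alternative x hx2 rfl with ⟨W, hxW, hiso, -⟩ | h
  · exact Or.inl ⟨W, hxW, hiso⟩
  · exact Or.inr h

end Tower

end Literature.AlgebraicGeometry.Resolution

end
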